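import Summits.QuantumFields.YangMills.Theorems.ColdStartUniversalityLatticeLangevinHaarSymmetry
import Summits.QuantumFields.YangMills.Theorems.ColdStartUniversalityLatticeLangevinDoeblinSZZ
import HarnessLib

/-!
# Route `ColdStartUniversality`, crux K_A1 `UniformColdStartMixing` (stmt-QuantumFields-24809), rung `stub_fixedCutoffMixing`:
# (Inv) wall, groundwork D — ridge eigen-expansion of the `β' = 0` kernels; continuity of the ground-state potential

Helper file (seat `ym-line-csu-p1`, g8).  Two small facts used by the integrated Duhamel identity:
* `integral_ridge_transitionKernel_beta_zero` — any Markov kernel family `κ⁰` realising the `β' = 0` transition laws acts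
  diagonally on ridge form: `κ⁰_τ (Σ_l c_l F_l)(x) = Σ_l c_l e^{-λ_l τ} F_l(x)` (`integral_prod_gegenbauer_latitude` through `hreal`
  and the regular flow); in particular ridge form is stable under `κ⁰_τ`;
* `continuous_groundStatePotential` / `exists_abs_groundStatePotential_le` — the ground-state potential
  `V̂ = ½ 𝓛_0 ψ̂ + ⅛ Γ(ψ̂,ψ̂)` is continuous, hence bounded in absolute value, on `SU(2)^E` (the proof of `exists_groundState_bounds`,
  which records only the one-sided bound).
No definition, no sorry.  RECORD-rung R3 plumbing; nothing here bears on the mass gap.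
-/

set_option autoImplicit false

noncomputable section

namespace Summit.QuantumFields.YangMills.Theorems.ColdStartUniversality

open MeasureTheory ProbabilityTheory Finset Filter
open scoped BigOperators NNReal ENNReal
open Literature.Probability.Process Literature.MathematicalPhysics.QuantumFieldTheory Literature.Analysis.SpecialFunctions
open Literature.MathematicalPhysics.QuantumLattice (fundamentalRep fundamentalLatticeRep)

variable {L : ℕ} [NeZero L]

/-- **The `β' = 0` kernels act diagonally on ridge form**: `κ⁰_τ (Σ_l c_l F_l)(x) = Σ_l c_l e^{-λ_l τ} F_l(x)`. [folklore] -/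
theorem integral_ridge_transitionKernel_beta_zero
    (κ₀ : ℝ≥0 → Kernel (GaugeConfig 3 L (Matrix.specialUnitaryGroup (Fin 2) ℂ))
      (GaugeConfig 3 L (Matrix.specialUnitaryGroup (Fin 2) ℂ))) [∀ t, IsMarkovKernel (κ₀ t)]
    (hreal₀ : ∀ (t : ℝ≥0) (x : GaugeConfig 3 L (Matrix.specialUnitaryGroup (Fin 2) ℂ))
        (Ω : Type) [MeasurableSpace Ω] (P : Measure Ω) [IsProbabilityMeasure P]
        (W : ℝ≥0 → Ω → (Edge 3 L × NoiseIdx 2 → ℝ)) (hW : IsFlatBrownian W P)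
        (U : ℝ≥0 → Ω → GaugeConfig 3 L (Matrix.specialUnitaryGroup (Fin 2) ℂ)),
        (∀ ω, U 0 ω = x) →
        (latticeLangevinDynamics (fundamentalLatticeRep 2) 0).IsSolution (fundamentalRep (Fin 2))
          hW.natFiltration P W U →
        κ₀ t x = P.map (U t))
    {ι : Type} [Fintype ι] (c : ι → ℝ) (g : ι → Edge 3 L → Matrix.specialUnitaryGroup (Fin 2) ℂ) (m : ι → Edge 3 L → ℕ)
    (τ : ℝ≥0) (x : GaugeConfig 3 L (Matrix.specialUnitaryGroup (Fin 2) ℂ)) :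
    ∫ y, (∑ l, c l * ∏ e, gegenbauerSum 1 (m l e) (hsForm 2 (fundamentalRep (Fin 2) (g l e)) (fundamentalRep (Fin 2) (y e)) / 2))
        ∂(κ₀ τ x) =
      ∑ l, c l * Real.exp (-(∑ e, (m l e : ℝ) * ((m l e : ℝ) + 2) / 2) * τ) *
        ∏ e, gegenbauerSum 1 (m l e) (hsForm 2 (fundamentalRep (Fin 2) (g l e)) (fundamentalRep (Fin 2) (x e)) / 2) := by
  classical
  haveI := secondCountableTopology_su2
  haveI := borelSpace_config L
  haveI := isProbabilityMeasure_piWiener (Edge 3 L × NoiseIdx 2)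
  have hWc := isFlatBrownian_piWiener 3 L (NoiseIdx 2)
  obtain ⟨Y, GY, hY, hYm, -, -, -⟩ := exists_regularFlow L 0 hWc
  have hκY : κ₀ τ x = (Measure.pi fun _ : Edge 3 L × NoiseIdx 2 => preWienerMeasure).map (Y x τ) :=
    hreal₀ τ x _ _ _ hWc (Y x) (hY x).1 (hY x).2
  have hmY : Measurable (Y x τ) := ((hY x).2.adapted τ).mono (hWc.natFiltration.le τ) le_rfl
  have hcl : ∀ l, Continuous fun y : GaugeConfig 3 L (Matrix.specialUnitaryGroup (Fin 2) ℂ) =>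
      ∏ e, gegenbauerSum 1 (m l e) (hsForm 2 (fundamentalRep (Fin 2) (g l e)) (fundamentalRep (Fin 2) (y e)) / 2) := fun l =>
    continuous_prod_gegenbauer_latitude (L := L) (g l) (m l)
  have hc : Continuous fun y : GaugeConfig 3 L (Matrix.specialUnitaryGroup (Fin 2) ℂ) =>
      ∑ l, c l * ∏ e, gegenbauerSum 1 (m l e) (hsForm 2 (fundamentalRep (Fin 2) (g l e)) (fundamentalRep (Fin 2) (y e)) / 2) :=
    continuous_finsetSum _ fun l _ => continuous_const.mul (hcl l)
  rw [hκY, integral_map hmY.aemeasurable hc.aestronglyMeasurable]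
  have hil : ∀ l, Integrable (fun ω => ∏ e, gegenbauerSum 1 (m l e)
      (hsForm 2 (fundamentalRep (Fin 2) (g l e)) (fundamentalRep (Fin 2) (Y x τ ω e)) / 2))
      (Measure.pi fun _ : Edge 3 L × NoiseIdx 2 => preWienerMeasure) := by
    intro l
    obtain ⟨M, -, hM⟩ := exists_abs_le_of_continuous (hcl l)
    exact Integrable.of_bound ((hcl l).measurable.comp hmY).aestronglyMeasurable M
      (Eventually.of_forall fun ω => by rw [Real.norm_eq_abs]; exact hM _)
  rw [integral_finsetSum _ fun l _ => (hil l).const_mul _]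
  refine Finset.sum_congr rfl fun l _ => ?_
  rw [MeasureTheory.integral_const_mul, integral_prod_gegenbauer_latitude hWc Y hY hYm x (g l) (m l) τ]
  ring

/-- The image of a ridge-form function under a `β' = 0` transition kernel is again in ridge form. [folklore] -/
theorem exists_ridge_transitionKernel_beta_zero
    (κ₀ : ℝ≥0 → Kernel (GaugeConfig 3 L (Matrix.specialUnitaryGroup (Fin 2) ℂ))
      (GaugeConfig 3 L (Matrix.specialUnitaryGroup (Fin 2) ℂ))) [∀ t, IsMarkovKernel (κ₀ t)]
    (hreal₀ : ∀ (t : ℝ≥0) (x : GaugeConfig 3 L (Matrix.specialUnitaryGroup (Fin 2) ℂ))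
        (Ω : Type) [MeasurableSpace Ω] (P : Measure Ω) [IsProbabilityMeasure P]
        (W : ℝ≥0 → Ω → (Edge 3 L × NoiseIdx 2 → ℝ)) (hW : IsFlatBrownian W P)
        (U : ℝ≥0 → Ω → GaugeConfig 3 L (Matrix.specialUnitaryGroup (Fin 2) ℂ)),
        (∀ ω, U 0 ω = x) →
        (latticeLangevinDynamics (fundamentalLatticeRep 2) 0).IsSolution (fundamentalRep (Fin 2))
          hW.natFiltration P W U →
        κ₀ t x = P.map (U t))
    {F : GaugeConfig 3 L (Matrix.specialUnitaryGroup (Fin 2) ℂ) → ℝ}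
    (hF : ∃ (ι : Type) (_ : Fintype ι) (c : ι → ℝ) (g : ι → Edge 3 L → Matrix.specialUnitaryGroup (Fin 2) ℂ)
      (m : ι → Edge 3 L → ℕ), ∀ V, F V = ∑ l, c l * ∏ e, gegenbauerSum 1 (m l e)
        (hsForm 2 (fundamentalRep (Fin 2) (g l e)) (fundamentalRep (Fin 2) (V e)) / 2))
    (τ : ℝ≥0) :
    ∃ (ι : Type) (_ : Fintype ι) (c : ι → ℝ) (g : ι → Edge 3 L → Matrix.specialUnitaryGroup (Fin 2) ℂ)
      (m : ι → Edge 3 L → ℕ), ∀ V, (∫ y, F y ∂(κ₀ τ V)) = ∑ l, c l * ∏ e, gegenbauerSum 1 (m l e)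
        (hsForm 2 (fundamentalRep (Fin 2) (g l e)) (fundamentalRep (Fin 2) (V e)) / 2) := by
  obtain ⟨ι, _, c, g, m, hFV⟩ := hF
  refine ⟨ι, inferInstance, fun l => c l * Real.exp (-(∑ e, (m l e : ℝ) * ((m l e : ℝ) + 2) / 2) * τ), g, m, fun V => ?_⟩
  have hfun : F = fun y => ∑ l, c l * ∏ e, gegenbauerSum 1 (m l e)
      (hsForm 2 (fundamentalRep (Fin 2) (g l e)) (fundamentalRep (Fin 2) (y e)) / 2) := funext hFV
  rw [hfun, integral_ridge_transitionKernel_beta_zero κ₀ hreal₀ c g m τ V]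

/-- **The ground-state potential `V̂` is continuous on `SU(2)^E`.** [folklore] -/
theorem continuous_groundStatePotential (β' : ℝ) :
    Continuous fun V : GaugeConfig 3 L (Matrix.specialUnitaryGroup (Fin 2) ℂ) =>
      (let x : (Edge 3 L × Fin 2 × Fin 2 × Bool) → ℝ := fun q =>
          (fun z : ℂ => if q.2.2.2 then z.im else z.re)
            ((fundamentalRep (Fin 2) (V q.1) : Matrix (Fin 2) (Fin 2) ℂ) q.2.1 q.2.2.1)
       let b₀ : (Edge 3 L × Fin 2 × Fin 2 × Bool) → ℝ := fun q =>
          (fun z : ℂ => if q.2.2.2 then z.im else z.re) ((latticeLangevinDynamics (fundamentalLatticeRep 2) 0).drift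
            (matrixConfig (fundamentalRep (Fin 2)) V) q.1 q.2.1 q.2.2.1)
       let σ : (Edge 3 L × Fin 2 × Fin 2 × Bool) → (Edge 3 L × NoiseIdx 2) → ℝ := fun q k =>
          if k.1 = q.1 then (fun z : ℂ => if q.2.2.2 then z.im else z.re)
            ((latticeLangevinDynamics (fundamentalLatticeRep 2) 0).noise
              (matrixConfig (fundamentalRep (Fin 2)) V) q.1 k.2 q.2.1 q.2.2.1) else 0
       let ψ : ((Edge 3 L × Fin 2 × Fin 2 × Bool) → ℝ) → ℝ := fun y =>
          β' * ∑ p : Plaquette 3 L, (rootedLoop (fun (e : Edge 3 L) (i j : Fin 2) =>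
            ((y (e, i, j, false) : ℝ) : ℂ) + ((y (e, i, j, true) : ℝ) : ℂ) * Complex.I) (p.1, p.2.1.1) p.2.1.2 false).trace.re
       1 / 2 * (∑ i, fderiv ℝ ψ x (Pi.single i 1) * b₀ i +
            1 / 2 * ∑ i, ∑ j, fderiv ℝ (fun z => fderiv ℝ ψ z (Pi.single i 1)) x (Pi.single j 1) * ∑ n, σ i n * σ j n) +
          1 / 8 * ∑ i, ∑ j, fderiv ℝ ψ x (Pi.single i 1) * fderiv ℝ ψ x (Pi.single j 1) * ∑ n, σ i n * σ j n) := by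
  classical
  let ψ : ((Edge 3 L × Fin 2 × Fin 2 × Bool) → ℝ) → ℝ := fun y =>
      β' * ∑ p : Plaquette 3 L, (rootedLoop (fun (e : Edge 3 L) (i j : Fin 2) =>
        ((y (e, i, j, false) : ℝ) : ℂ) + ((y (e, i, j, true) : ℝ) : ℂ) * Complex.I) (p.1, p.2.1.1) p.2.1.2 false).trace.re
  have hψ2 : ContDiff ℝ 2 ψ := contDiff_psiHat (d := 3) (L := L) (N := 2) (n := 2) β'
  have hco := continuous_coords (L := L)
  have hG := continuous_generator (L := L) 0 (f := ψ) hψ2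
  have hd1 : ∀ v, Continuous fun y : Edge 3 L × Fin 2 × Fin 2 × Bool → ℝ => fderiv ℝ ψ y v := fun v =>
    (hψ2.continuous_fderiv (by norm_num)).clm_apply continuous_const
  have hnoise : ∀ (i : Edge 3 L × Fin 2 × Fin 2 × Bool) (n : Edge 3 L × NoiseIdx 2), Continuous fun V : GaugeConfig 3 L
      (Matrix.specialUnitaryGroup (Fin 2) ℂ) => (if n.1 = i.1 then (fun z : ℂ => if i.2.2.2 then z.im else z.re)
        ((latticeLangevinDynamics (fundamentalLatticeRep 2) 0).noise (matrixConfig (fundamentalRep (Fin 2)) V)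
          i.1 n.2 i.2.1 i.2.2.1) else 0) := by
    intro i n
    by_cases h : n.1 = i.1
    · simp only [if_pos h]
      have hc := (continuous_apply i.2.2.1).comp ((continuous_apply i.2.1).comp (continuous_noise_matrixConfig (L := L) 0 i.1 n.2))
      cases i.2.2.2
      · exact Complex.continuous_re.comp hc
      · exact Complex.continuous_im.comp hc
    · simp only [if_neg h]; exact continuous_const
  have hΓ : Continuous fun V : GaugeConfig 3 L (Matrix.specialUnitaryGroup (Fin 2) ℂ) =>
      ∑ i : Edge 3 L × Fin 2 × Fin 2 × Bool, ∑ j : Edge 3 L × Fin 2 × Fin 2 × Bool,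
        fderiv ℝ ψ (fun q : Edge 3 L × Fin 2 × Fin 2 × Bool => (fun z : ℂ => if q.2.2.2 then z.im else z.re)
            ((fundamentalRep (Fin 2) (V q.1) : Matrix (Fin 2) (Fin 2) ℂ) q.2.1 q.2.2.1)) (Pi.single i 1) *
          fderiv ℝ ψ (fun q : Edge 3 L × Fin 2 × Fin 2 × Bool => (fun z : ℂ => if q.2.2.2 then z.im else z.re)
            ((fundamentalRep (Fin 2) (V q.1) : Matrix (Fin 2) (Fin 2) ℂ) q.2.1 q.2.2.1)) (Pi.single j 1) *
          ∑ n : Edge 3 L × NoiseIdx 2,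
            (if n.1 = i.1 then (fun z : ℂ => if i.2.2.2 then z.im else z.re)
              ((latticeLangevinDynamics (fundamentalLatticeRep 2) 0).noise
                (matrixConfig (fundamentalRep (Fin 2)) V) i.1 n.2 i.2.1 i.2.2.1) else 0) *
            (if n.1 = j.1 then (fun z : ℂ => if j.2.2.2 then z.im else z.re)
              ((latticeLangevinDynamics (fundamentalLatticeRep 2) 0).noise
                (matrixConfig (fundamentalRep (Fin 2)) V) j.1 n.2 j.2.1 j.2.2.1) else 0) := by
    refine continuous_finsetSum _ fun i _ => continuous_finsetSum _ fun j _ => ?_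
    exact (((hd1 _).comp hco).mul ((hd1 _).comp hco)).mul (continuous_finsetSum _ fun n _ => (hnoise i n).mul (hnoise j n))
  have hV := ((continuous_const (y := (1 / 2 : ℝ))).mul hG).add ((continuous_const (y := (1 / 8 : ℝ))).mul hΓ)
  exact hV

/-- **The ground-state potential is bounded in absolute value on `SU(2)^E`.** [folklore] -/
theorem exists_abs_groundStatePotential_le (β' : ℝ) :
    ∃ K : ℝ, 0 ≤ K ∧ ∀ V : GaugeConfig 3 L (Matrix.specialUnitaryGroup (Fin 2) ℂ),
      |(let x : (Edge 3 L × Fin 2 × Fin 2 × Bool) → ℝ := fun q =>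
          (fun z : ℂ => if q.2.2.2 then z.im else z.re)
            ((fundamentalRep (Fin 2) (V q.1) : Matrix (Fin 2) (Fin 2) ℂ) q.2.1 q.2.2.1)
        let b₀ : (Edge 3 L × Fin 2 × Fin 2 × Bool) → ℝ := fun q =>
          (fun z : ℂ => if q.2.2.2 then z.im else z.re) ((latticeLangevinDynamics (fundamentalLatticeRep 2) 0).drift
            (matrixConfig (fundamentalRep (Fin 2)) V) q.1 q.2.1 q.2.2.1)
        let σ : (Edge 3 L × Fin 2 × Fin 2 × Bool) → (Edge 3 L × NoiseIdx 2) → ℝ := fun q k =>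
          if k.1 = q.1 then (fun z : ℂ => if q.2.2.2 then z.im else z.re)
            ((latticeLangevinDynamics (fundamentalLatticeRep 2) 0).noise
              (matrixConfig (fundamentalRep (Fin 2)) V) q.1 k.2 q.2.1 q.2.2.1) else 0
        let ψ : ((Edge 3 L × Fin 2 × Fin 2 × Bool) → ℝ) → ℝ := fun y =>
          β' * ∑ p : Plaquette 3 L, (rootedLoop (fun (e : Edge 3 L) (i j : Fin 2) =>
            ((y (e, i, j, false) : ℝ) : ℂ) + ((y (e, i, j, true) : ℝ) : ℂ) * Complex.I) (p.1, p.2.1.1) p.2.1.2 false).trace.re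
        1 / 2 * (∑ i, fderiv ℝ ψ x (Pi.single i 1) * b₀ i +
            1 / 2 * ∑ i, ∑ j, fderiv ℝ (fun z => fderiv ℝ ψ z (Pi.single i 1)) x (Pi.single j 1) * ∑ n, σ i n * σ j n) +
          1 / 8 * ∑ i, ∑ j, fderiv ℝ ψ x (Pi.single i 1) * fderiv ℝ ψ x (Pi.single j 1) * ∑ n, σ i n * σ j n)| ≤ K :=
  exists_abs_le_of_continuous (continuous_groundStatePotential (L := L) β')

end Summit.QuantumFields.YangMills.Theorems.ColdStartUniversality

end
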